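import Summits.NavierStokesRegularity.NavierStokesRegularity.Theorems.RellichScarSymmetricScarExistsGaussianWindowLaw
import HarnessLib

/-!
# Crux `NoTypeIBlowup` (stmt-NavierStokesRegularity-1217), line `head-flux-channel`:
  helper 1 of STUB S2c (`stub_gaussianEnergyDeriv`) — Gaussian integrations by parts
  WITHOUT spatial decay

-- adapted from Cruxes/Target/S2cProof.lean (refuter-drefute), Part 1; copied, not imported.

The sibling crux file `Theorems/RellichScarSymmetricScarExistsGaussianWindowLaw(.Lemmas).lean`
integrates the terms of Leray's backward system against the Ornstein–Uhlenbeck Gaussian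
`g(y) = e^{−|y|²/4}` (`PineauVicol2026.gaussWeight`, `∇g = −½ y g`) for fields of the DECAY class
`(1 + |y|)|V| ≤ A`.  The Leray orbit `U = lerayOrbit u` of a Type-I ancient mild field has no
spatial decay, only the RATE-class bounds `|U| ≤ C`, `|DU| ≤ K₀`, `|D²U| ≤ B₂`; the decay entered
those proofs only through the dominations, which here become `const · (1 + |y|)ᴺ · g`
(`integrable_of_norm_le_mul_gaussWeight … N`, `N ≤ 2`).  This file re-runs, for a
finite-dimensional real inner product space `E` and a field `V ∈ C¹` (resp. `C²`) with
`|V| ≤ A`, `|DV| ≤ B` (resp. `|D²V| ≤ B`):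

* `integral_inner_convect_mul_gaussWeight'` — `∫ ⟨V, (V·∇)V⟩ g = ¼ ∫ |V|² (y·V) g` (`div V = 0`);
* `integral_inner_gradient_mul_gaussWeight'` — `∫ ⟨V, ∇Q⟩ g = ½ ∫ Q (y·V) g` for `Q ∈ C¹` of
  LINEAR GROWTH `|Q y| ≤ K(1 + |y|)` with `|∇Q| ≤ B` (`div V = 0`);
* `integral_inner_laplacian_mul_gaussWeight'` — `∫ ⟨V, ΔV⟩ g = −∫ |DV|²_F g + ½ ∫ ⟨V, DV y⟩ g`
  (one integration by parts per coordinate direction, Mathlib's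
  `integral_bilinear_hasFDerivAt_right_eq_neg_left_of_integrable`; `∂ᵢ g = −½ yᵢ g`);

and its `ℝ³` form `gaussianEnergyIBP_laplacian` (registered sub-goal of the crux item).
Everything is folklore calculus, fully proved.  Lands `--supports stmt-NavierStokesRegularity-1217`.
-/

noncomputable section

namespace Summit.NavierStokesRegularity.NavierStokesRegularity.Theorems.HeadFluxChannelS2c

open MeasureTheory Set Filter Topology Function InnerProductSpace
open scoped RealInnerProductSpace Laplacian ContDiff
open Literature.Analysis Literature.Analysis.FluidPDE
open Literature.Analysis.FluidPDE.PineauVicol2026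
open Summit.NavierStokesRegularity.NavierStokesRegularity.Theorems
open Summit.NavierStokesRegularity.NavierStokesRegularity.Theorems.SymmetricScarExists.LogtimeBernoulli

variable {E : Type*} [NormedAddCommGroup E] [InnerProductSpace ℝ E] [FiniteDimensional ℝ E]
  [MeasurableSpace E] [BorelSpace E]

/-! ## Integrability of the weighted integrands (rate class) -/

/-- `‖V‖² (y·V) g` is integrable for a bounded continuous field (bound `A³‖y‖ g`). [folklore] -/
theorem integrable_norm_sq_mul_inner_id_mul_gaussWeight' {V : E → E} (cV : Continuous V) {A : ℝ}
    (hA : ∀ y, ‖V y‖ ≤ A) : Integrable fun y => ‖V y‖ ^ 2 * ⟪y, V y⟫ * gaussWeight y := by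
  have hA0 : 0 ≤ A := (norm_nonneg _).trans (hA 0)
  refine integrable_of_norm_le_mul_gaussWeight (M := A ^ 2 * A)
    ((((cV.norm.pow 2).mul (continuous_id.inner cV)).mul continuous_gaussWeight).aestronglyMeasurable)
    1 fun y => ?_
  have hgy := (gaussWeight_pos y).le
  rw [norm_mul, norm_mul, Real.norm_of_nonneg hgy, Real.norm_of_nonneg (sq_nonneg _), Real.norm_eq_abs]
  have e1 : ‖V y‖ ^ 2 ≤ A ^ 2 := pow_le_pow_left₀ (norm_nonneg _) (hA y) 2
  have e2 : |⟪y, V y⟫| ≤ (1 + ‖y‖) ^ 1 * A := by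
    refine (abs_real_inner_le_norm _ _).trans ?_
    rw [pow_one]
    exact mul_le_mul (by linarith [norm_nonneg y]) (hA y) (norm_nonneg _) (by positivity)
  calc ‖V y‖ ^ 2 * |⟪y, V y⟫| * gaussWeight y ≤ A ^ 2 * ((1 + ‖y‖) ^ 1 * A) * gaussWeight y :=
        mul_le_mul_of_nonneg_right (mul_le_mul e1 e2 (abs_nonneg _) (by positivity)) hgy
    _ = A ^ 2 * A * (1 + ‖y‖) ^ 1 * gaussWeight y := by ring

/-- `Q (y·V) g` is integrable for continuous `Q` of linear growth and bounded continuous `V`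
(bound `K A (1+‖y‖)² g`). [folklore] -/
theorem integrable_mul_inner_id_mul_gaussWeight' {f : E → ℝ} {V : E → E} (cf : Continuous f)
    (cV : Continuous V) {A K : ℝ} (hf : ∀ y, |f y| ≤ K * (1 + ‖y‖)) (hA : ∀ y, ‖V y‖ ≤ A) :
    Integrable fun y => f y * ⟪y, V y⟫ * gaussWeight y := by
  have hA0 : 0 ≤ A := (norm_nonneg _).trans (hA 0)
  have hK0 : 0 ≤ K := by have h := (abs_nonneg _).trans (hf 0); simpa using h
  refine integrable_of_norm_le_mul_gaussWeight (M := K * A)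
    (((cf.mul (continuous_id.inner cV)).mul continuous_gaussWeight).aestronglyMeasurable) 2 fun y => ?_
  have hgy := (gaussWeight_pos y).le
  have hy0 := norm_nonneg y
  rw [norm_mul, norm_mul, Real.norm_of_nonneg hgy, Real.norm_eq_abs, Real.norm_eq_abs]
  have e2 : |⟪y, V y⟫| ≤ (1 + ‖y‖) * A :=
    (abs_real_inner_le_norm _ _).trans (mul_le_mul (by linarith) (hA y) (norm_nonneg _) (by positivity))
  calc |f y| * |⟪y, V y⟫| * gaussWeight y ≤ K * (1 + ‖y‖) * ((1 + ‖y‖) * A) * gaussWeight y :=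
        mul_le_mul_of_nonneg_right (mul_le_mul (hf y) e2 (abs_nonneg _) (by positivity)) hgy
    _ = K * A * (1 + ‖y‖) ^ 2 * gaussWeight y := by ring

/-- `⟨V, DV y⟩ g` is integrable for bounded `V ∈ C¹` with bounded gradient (bound `A B ‖y‖ g`). [folklore] -/
theorem integrable_inner_fderiv_apply_id_mul_gaussWeight' {V : E → E} (hV : ContDiff ℝ 1 V)
    {A B : ℝ} (hA : ∀ y, ‖V y‖ ≤ A) (h1 : ∀ y, ‖fderiv ℝ V y‖ ≤ B) :
    Integrable fun y => ⟪V y, fderiv ℝ V y y⟫ * gaussWeight y := by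
  have hA0 : 0 ≤ A := (norm_nonneg _).trans (hA 0)
  have hB0 : 0 ≤ B := (norm_nonneg _).trans (h1 0)
  refine integrable_of_norm_le_mul_gaussWeight (M := A * B)
    (((hV.continuous.inner ((hV.continuous_fderiv one_ne_zero).clm_apply continuous_id)).mul
      continuous_gaussWeight).aestronglyMeasurable) 1 fun y => ?_
  have hgy := (gaussWeight_pos y).le
  rw [norm_mul, Real.norm_of_nonneg hgy]
  refine mul_le_mul_of_nonneg_right ((norm_inner_le_norm _ _).trans ?_) hgy
  have hy1 : ‖y‖ ≤ (1 + ‖y‖) ^ 1 := by rw [pow_one]; linarith [norm_nonneg y]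
  calc ‖V y‖ * ‖fderiv ℝ V y y‖ ≤ A * (B * ‖y‖) :=
        mul_le_mul (hA y) ((ContinuousLinearMap.le_opNorm _ _).trans
          (mul_le_mul_of_nonneg_right (h1 y) (norm_nonneg _))) (norm_nonneg _) hA0
    _ = A * B * ‖y‖ := by ring
    _ ≤ A * B * (1 + ‖y‖) ^ 1 := mul_le_mul_of_nonneg_left hy1 (by positivity)

/-- **The transport term against the Gaussian weight, bounded field.** For a divergence-free
`V ∈ C¹` with `‖V‖ ≤ A`, `‖DV‖ ≤ B`: `∫ ⟨V, (V·∇)V⟩ g = ¼ ∫ |V|² (y·V) g`. [folklore] -/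
theorem integral_inner_convect_mul_gaussWeight' {V : E → E} (hV : ContDiff ℝ 1 V)
    (hdiv : VectorCalculus.IsDivFree V) {A B : ℝ}
    (hA : ∀ y, ‖V y‖ ≤ A) (h1 : ∀ y, ‖fderiv ℝ V y‖ ≤ B) :
    ∫ y, ⟪V y, fderiv ℝ V y (V y)⟫ * gaussWeight y =
      (1 / 4 : ℝ) * ∫ y, ‖V y‖ ^ 2 * ⟪y, V y⟫ * gaussWeight y := by
  haveI : CompleteSpace E := FiniteDimensional.complete ℝ E
  have hB0 : 0 ≤ B := (norm_nonneg _).trans (h1 0)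
  have hg0 : ∀ y : E, 0 ≤ gaussWeight y := fun y => (gaussWeight_pos y).le
  have cV : Continuous V := hV.continuous
  have cDV : Continuous (fderiv ℝ V) := hV.continuous_fderiv one_ne_zero
  have hθ : ContDiff ℝ 1 fun y => ‖V y‖ ^ 2 := hV.norm_sq ℝ
  have hu : ContDiff ℝ 1 fun y => gaussWeight y • V y := (contDiff_gaussWeight (n := 1)).smul hV
  have hgrad : ∀ y, ⟪gaussWeight y • V y, gradient (fun z => ‖V z‖ ^ 2) y⟫ =
      2 * (⟪V y, fderiv ℝ V y (V y)⟫ * gaussWeight y) := by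
    intro y
    rw [real_inner_smul_left, real_inner_comm, inner_gradient_left,
      ((hV.differentiable one_ne_zero y).hasFDerivAt.norm_sq).fderiv, two_smul]
    simp only [add_apply, ContinuousLinearMap.comp_apply, innerSL_apply_apply]
    ring
  have hdivg : ∀ y, ‖V y‖ ^ 2 * VectorCalculus.divergence (fun z => gaussWeight z • V z) y =
      (-(1 / 2 : ℝ)) * (‖V y‖ ^ 2 * ⟪y, V y⟫ * gaussWeight y) := by
    intro y; rw [divergence_gaussWeight_smul hV hdiv y]; ring
  have iF : Integrable fun y => ⟪V y, fderiv ℝ V y (V y)⟫ * gaussWeight y :=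
    integrable_inner_mul_gaussWeight cV (cDV.clm_apply cV) hA fun y =>
      (ContinuousLinearMap.le_opNorm _ _).trans (mul_le_mul (h1 y) (hA y) (norm_nonneg _) hB0)
  have iG : Integrable fun y => ‖V y‖ ^ 2 * ⟪y, V y⟫ * gaussWeight y :=
    integrable_norm_sq_mul_inner_id_mul_gaussWeight' cV hA
  have hint : Integrable fun y => ‖V y‖ ^ 2 • (gaussWeight y • V y) := by
    refine integrable_of_norm_le_const_mul_gaussWeight (M := A ^ 2 * A) ?_ ?_
    · exact ((cV.norm.pow 2).smul (continuous_gaussWeight.smul cV)).aestronglyMeasurable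
    · intro y
      have hgy := hg0 y
      rw [norm_smul, norm_smul, Real.norm_of_nonneg (sq_nonneg _), Real.norm_of_nonneg (hg0 y)]
      calc ‖V y‖ ^ 2 * (gaussWeight y * ‖V y‖) ≤ A ^ 2 * (gaussWeight y * A) :=
            mul_le_mul (pow_le_pow_left₀ (norm_nonneg _) (hA y) 2)
              (mul_le_mul_of_nonneg_left (hA y) hgy) (by positivity) (by positivity)
        _ = A ^ 2 * A * gaussWeight y := by ring
  have h₁ : Integrable fun y => ‖V y‖ ^ 2 * VectorCalculus.divergence (fun z => gaussWeight z • V z) y := by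
    simp_rw [hdivg]; exact iG.const_mul _
  have h₂ : Integrable fun y => ⟪gaussWeight y • V y, gradient (fun z => ‖V z‖ ^ 2) y⟫ := by
    simp_rw [hgrad]; exact iF.const_mul _
  have key := integral_mul_divergence_add_eq_zero_of_integrable hθ hu hint h₁ h₂
  simp_rw [hdivg, hgrad] at key
  rw [integral_const_mul, integral_const_mul] at key
  linarith

/-! ## The pressure and viscous terms against the Gaussian weight (rate class) -/

/-- **The pressure term against the Gaussian weight, linearly growing pressure.** For a
divergence-free `V ∈ C¹` with `‖V‖ ≤ A` and `Q ∈ C¹` with `|Q y| ≤ K(1+‖y‖)`, `‖∇Q‖ ≤ B`: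
`∫ ⟨V, ∇Q⟩ g = ½ ∫ Q (y·V) g`. [folklore] -/
theorem integral_inner_gradient_mul_gaussWeight' {V : E → E} {Q : E → ℝ} (hV : ContDiff ℝ 1 V)
    (hQ : ContDiff ℝ 1 Q) (hdiv : VectorCalculus.IsDivFree V) {A B K : ℝ}
    (hA : ∀ y, ‖V y‖ ≤ A) (hQb : ∀ y, |Q y| ≤ K * (1 + ‖y‖)) (hQg : ∀ y, ‖gradient Q y‖ ≤ B) :
    ∫ y, ⟪V y, gradient Q y⟫ * gaussWeight y =
      (1 / 2 : ℝ) * ∫ y, Q y * ⟪y, V y⟫ * gaussWeight y := by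
  haveI : CompleteSpace E := FiniteDimensional.complete ℝ E
  have hA0 : 0 ≤ A := (norm_nonneg _).trans (hA 0)
  have hK0 : 0 ≤ K := by have h := (abs_nonneg _).trans (hQb 0); simpa using h
  have hg0 : ∀ y : E, 0 ≤ gaussWeight y := fun y => (gaussWeight_pos y).le
  have cV : Continuous V := hV.continuous
  have cQ : Continuous Q := hQ.continuous
  have hu : ContDiff ℝ 1 fun y => gaussWeight y • V y := (contDiff_gaussWeight (n := 1)).smul hV
  have hdivg : ∀ y, Q y * VectorCalculus.divergence (fun z => gaussWeight z • V z) y =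
      (-(1 / 2 : ℝ)) * (Q y * ⟪y, V y⟫ * gaussWeight y) := by
    intro y; rw [divergence_gaussWeight_smul hV hdiv y]; ring
  have hgr : ∀ y, ⟪gaussWeight y • V y, gradient Q y⟫ = ⟪V y, gradient Q y⟫ * gaussWeight y := by
    intro y; rw [real_inner_smul_left, mul_comm]
  have iF : Integrable fun y => ⟪V y, gradient Q y⟫ * gaussWeight y :=
    integrable_inner_mul_gaussWeight cV (continuous_gradient_of_contDiff hQ) hA hQg
  have iG : Integrable fun y => Q y * ⟪y, V y⟫ * gaussWeight y :=
    integrable_mul_inner_id_mul_gaussWeight' cQ cV hQb hA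
  have hint : Integrable fun y => Q y • (gaussWeight y • V y) := by
    refine integrable_of_norm_le_mul_gaussWeight (M := K * A) ?_ 1 ?_
    · exact (cQ.smul (continuous_gaussWeight.smul cV)).aestronglyMeasurable
    · intro y
      have hgy := hg0 y
      rw [norm_smul, norm_smul, Real.norm_of_nonneg (hg0 y), Real.norm_eq_abs, pow_one]
      calc |Q y| * (gaussWeight y * ‖V y‖) ≤ K * (1 + ‖y‖) * (gaussWeight y * A) :=
            mul_le_mul (hQb y) (mul_le_mul_of_nonneg_left (hA y) hgy) (by positivity) (by positivity)
        _ = K * A * (1 + ‖y‖) * gaussWeight y := by ring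
  have h₁ : Integrable fun y => Q y * VectorCalculus.divergence (fun z => gaussWeight z • V z) y := by
    simp_rw [hdivg]; exact iG.const_mul _
  have h₂ : Integrable fun y => ⟪gaussWeight y • V y, gradient Q y⟫ := by
    simp_rw [hgr]; exact iF
  have key := integral_mul_divergence_add_eq_zero_of_integrable hQ hu hint h₁ h₂
  simp_rw [hdivg, hgr] at key
  rw [integral_const_mul] at key
  linarith

/-- **The Laplacian against the Gaussian weight, bounded (non-decaying) field.** For `V ∈ C²`
with `‖V‖ ≤ A`, `‖DV‖ ≤ B`, `‖D²V‖ ≤ B`: `∫ ⟨V, ΔV⟩ g = −∫ |DV|²_F g + ½ ∫ ⟨V, DV y⟩ g`. [folklore] -/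
theorem integral_inner_laplacian_mul_gaussWeight' {V : E → E} (hV : ContDiff ℝ 2 V) {A B : ℝ}
    (hA : ∀ y, ‖V y‖ ≤ A) (h1 : ∀ y, ‖fderiv ℝ V y‖ ≤ B)
    (h2 : ∀ y, ‖iteratedFDeriv ℝ 2 V y‖ ≤ B) :
    ∫ y, ⟪V y, (Δ V) y⟫ * gaussWeight y =
      -(∫ y, frobeniusNormSq (fderiv ℝ V y) * gaussWeight y) +
        (1 / 2 : ℝ) * ∫ y, ⟪V y, fderiv ℝ V y y⟫ * gaussWeight y := by
  set b := stdOrthonormalBasis ℝ E with hb_def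
  have hV1 : ContDiff ℝ 1 V := hV.of_le one_le_two
  have hD : ContDiff ℝ 1 (fderiv ℝ V) := hV.fderiv_right (m := 1) le_rfl
  have hA0 : 0 ≤ A := (norm_nonneg _).trans (hA 0)
  have hB0 : 0 ≤ B := (norm_nonneg _).trans (h1 0)
  have hg0 : ∀ y : E, 0 ≤ gaussWeight y := fun y => (gaussWeight_pos y).le
  have cV : Continuous V := hV.continuous
  have cDV : Continuous (fderiv ℝ V) := hV.continuous_fderiv two_ne_zero
  have cD2 : Continuous (fderiv ℝ (fderiv ℝ V)) := hD.continuous_fderiv one_ne_zero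
  have cg : Continuous (gaussWeight : E → ℝ) := continuous_gaussWeight
  have hf : ∀ y, HasFDerivAt (fun z => gaussWeight z • V z)
      (gaussWeight y • fderiv ℝ V y + (fderiv ℝ gaussWeight y).smulRight (V y)) y := fun y =>
    ((contDiff_gaussWeight (n := 1)).differentiable one_ne_zero y).hasFDerivAt.smul
      (hV1.differentiable one_ne_zero y).hasFDerivAt
  have hg : ∀ i y, HasFDerivAt (fun z => fderiv ℝ V z (b i))
      ((ContinuousLinearMap.apply ℝ E (b i)).comp (fderiv ℝ (fderiv ℝ V) y)) y := fun i y =>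
    (ContinuousLinearMap.apply ℝ E (b i)).hasFDerivAt.comp y (hD.differentiable one_ne_zero y).hasFDerivAt
  have hDi : ∀ i y, ‖fderiv ℝ V y (b i)‖ ≤ B := fun i y =>
    (norm_apply_orthonormalBasis_le b i _).trans (h1 y)
  have hD2i : ∀ i y, ‖fderiv ℝ (fderiv ℝ V) y (b i) (b i)‖ ≤ B := fun i y =>
    (norm_fderiv_fderiv_apply_le b V y i i).trans (h2 y)
  -- the weight derivative now carries the linear factor `‖y‖`
  have hdg : ∀ i y, ‖fderiv ℝ gaussWeight y (b i) • V y‖ ≤ (1 / 2 : ℝ) * A * ‖y‖ * gaussWeight y := by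
    intro i y
    rw [fderiv_gaussWeight_apply, norm_smul, Real.norm_eq_abs, abs_mul, abs_mul,
      abs_of_nonneg (hg0 y), show |(-(1 / 2 : ℝ))| = 1 / 2 by norm_num]
    have hgy := hg0 y
    have e1 : |⟪y, b i⟫| ≤ ‖y‖ := by
      rw [real_inner_comm]; exact abs_inner_orthonormalBasis_le b i y
    calc 1 / 2 * gaussWeight y * |⟪y, b i⟫| * ‖V y‖
        ≤ 1 / 2 * gaussWeight y * ‖y‖ * A :=
          mul_le_mul (mul_le_mul_of_nonneg_left e1 (by positivity)) (hA y) (norm_nonneg _)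
            (by positivity)
      _ = (1 / 2 : ℝ) * A * ‖y‖ * gaussWeight y := by ring
  have I1 : ∀ i, Integrable (fun y => ⟪gaussWeight y • fderiv ℝ V y (b i) +
      fderiv ℝ gaussWeight y (b i) • V y, fderiv ℝ V y (b i)⟫) := by
    intro i
    refine integrable_of_norm_le_mul_gaussWeight (M := (B + (1 / 2 : ℝ) * A) * B) ?_ 1 ?_
    · exact (((cg.smul (cDV.clm_apply continuous_const)).add
        (((contDiff_gaussWeight (n := 1)).continuous_fderiv one_ne_zero).clm_apply
          continuous_const |>.smul cV)).inner (cDV.clm_apply continuous_const)).aestronglyMeasurable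
    · intro y
      have hgy := hg0 y
      have hy0 := norm_nonneg y
      refine (norm_inner_le_norm _ _).trans ?_
      have e1 : ‖gaussWeight y • fderiv ℝ V y (b i) + fderiv ℝ gaussWeight y (b i) • V y‖ ≤
          (B + (1 / 2 : ℝ) * A) * (1 + ‖y‖) * gaussWeight y := by
        refine (norm_add_le _ _).trans ?_
        rw [norm_smul, Real.norm_of_nonneg (hg0 y)]
        have hB' : gaussWeight y * ‖fderiv ℝ V y (b i)‖ ≤ gaussWeight y * B :=
          mul_le_mul_of_nonneg_left (hDi i y) (hg0 y)
        have hd' := hdg i y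
        nlinarith [mul_nonneg hB0 (mul_nonneg hy0 hgy), mul_nonneg hA0 hgy]
      calc ‖gaussWeight y • fderiv ℝ V y (b i) + fderiv ℝ gaussWeight y (b i) • V y‖ *
            ‖fderiv ℝ V y (b i)‖
          ≤ (B + (1 / 2 : ℝ) * A) * (1 + ‖y‖) * gaussWeight y * B :=
            mul_le_mul e1 (hDi i y) (norm_nonneg _) (by positivity)
        _ = (B + (1 / 2 : ℝ) * A) * B * (1 + ‖y‖) ^ 1 * gaussWeight y := by ring
  have I2 : ∀ i, Integrable (fun y => ⟪gaussWeight y • V y, fderiv ℝ (fderiv ℝ V) y (b i) (b i)⟫) :=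
    fun i => (integrable_inner_mul_gaussWeight cV ((cD2.clm_apply continuous_const).clm_apply
      continuous_const) hA (hD2i i)).congr (Eventually.of_forall fun y => by
        simp only; rw [real_inner_smul_left, mul_comm])
  have I3 : ∀ i, Integrable (fun y => ⟪gaussWeight y • V y, fderiv ℝ V y (b i)⟫) :=
    fun i => (integrable_inner_mul_gaussWeight cV (cDV.clm_apply continuous_const) hA
      (hDi i)).congr (Eventually.of_forall fun y => by simp only; rw [real_inner_smul_left, mul_comm])
  have hibp : ∀ i, ∫ y, ⟪gaussWeight y • V y, fderiv ℝ (fderiv ℝ V) y (b i) (b i)⟫ =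
      -∫ y, ⟪gaussWeight y • fderiv ℝ V y (b i) + fderiv ℝ gaussWeight y (b i) • V y,
        fderiv ℝ V y (b i)⟫ := by
    intro i
    have H := integral_bilinear_hasFDerivAt_right_eq_neg_left_of_integrable
      (μ := (volume : Measure E)) (f := fun z => gaussWeight z • V z)
      (f' := fun y => gaussWeight y • fderiv ℝ V y + (fderiv ℝ gaussWeight y).smulRight (V y))
      (g := fun z => fderiv ℝ V z (b i))
      (g' := fun y => (ContinuousLinearMap.apply ℝ E (b i)).comp (fderiv ℝ (fderiv ℝ V) y))
      (v := b i) (B := innerSL ℝ) (I1 i) (I2 i) (I3 i) (fun y _ => hf y) (fun y _ => hg i y)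
    exact H
  have J1 : ∀ i, Integrable (fun y => ‖fderiv ℝ V y (b i)‖ ^ 2 * gaussWeight y) := fun i =>
    integrable_norm_sq_mul_gaussWeight' (cDV.clm_apply continuous_const) (hDi i)
  have J2 : ∀ i, Integrable (fun y => ⟪y, b i⟫ * ⟪V y, fderiv ℝ V y (b i)⟫ * gaussWeight y) := by
    intro i
    refine integrable_of_norm_le_mul_gaussWeight (M := A * B) ?_ 1 ?_
    · exact (((continuous_id.inner continuous_const).mul
        (cV.inner (cDV.clm_apply continuous_const))).mul cg).aestronglyMeasurable
    · intro y
      rw [norm_mul, norm_mul, Real.norm_of_nonneg (hg0 y), Real.norm_eq_abs, Real.norm_eq_abs]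
      have e1 : |⟪y, b i⟫| ≤ ‖y‖ := by
        rw [real_inner_comm]; exact abs_inner_orthonormalBasis_le b i y
      have e2 : |⟪V y, fderiv ℝ V y (b i)⟫| ≤ A * B :=
        (abs_real_inner_le_norm _ _).trans (mul_le_mul (hA y) (hDi i y) (norm_nonneg _) hA0)
      have hgy := hg0 y
      have hy1 : ‖y‖ ≤ (1 + ‖y‖) ^ 1 := by rw [pow_one]; linarith [norm_nonneg y]
      calc |⟪y, b i⟫| * |⟪V y, fderiv ℝ V y (b i)⟫| * gaussWeight y
          ≤ (1 + ‖y‖) ^ 1 * (A * B) * gaussWeight y :=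
            mul_le_mul_of_nonneg_right (mul_le_mul (e1.trans hy1) e2 (abs_nonneg _) (by positivity)) hgy
        _ = A * B * (1 + ‖y‖) ^ 1 * gaussWeight y := by ring
  have eL : ∀ y, ⟪V y, (Δ V) y⟫ * gaussWeight y =
      ∑ i, ⟪gaussWeight y • V y, fderiv ℝ (fderiv ℝ V) y (b i) (b i)⟫ := by
    intro y
    rw [laplacian_apply_eq_sum_fderiv_fderiv b V y, ← inner_sum, real_inner_smul_left, mul_comm]
  have eR : ∀ i y, ⟪gaussWeight y • fderiv ℝ V y (b i) + fderiv ℝ gaussWeight y (b i) • V y,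
      fderiv ℝ V y (b i)⟫ =
      ‖fderiv ℝ V y (b i)‖ ^ 2 * gaussWeight y +
        (-(1 / 2 : ℝ)) * (⟪y, b i⟫ * ⟪V y, fderiv ℝ V y (b i)⟫ * gaussWeight y) := by
    intro i y
    rw [inner_add_left, real_inner_smul_left, real_inner_smul_left, real_inner_self_eq_norm_sq,
      fderiv_gaussWeight_apply]
    ring
  have eY : ∀ y, ∑ i, ⟪y, b i⟫ * ⟪V y, fderiv ℝ V y (b i)⟫ * gaussWeight y =
      ⟪V y, fderiv ℝ V y y⟫ * gaussWeight y := by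
    intro y
    have e : fderiv ℝ V y (∑ i, ⟪b i, y⟫ • b i) = ∑ i, ⟪b i, y⟫ • fderiv ℝ V y (b i) := by
      rw [map_sum]
      exact Finset.sum_congr rfl fun i _ => by rw [map_smul]
    rw [b.sum_repr' y] at e
    rw [e, inner_sum, Finset.sum_mul]
    refine Finset.sum_congr rfl fun i _ => ?_
    rw [real_inner_smul_right, real_inner_comm (b i)]
  calc ∫ y, ⟪V y, (Δ V) y⟫ * gaussWeight y
      = ∫ y, ∑ i, ⟪gaussWeight y • V y, fderiv ℝ (fderiv ℝ V) y (b i) (b i)⟫ :=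
        integral_congr_ae (Eventually.of_forall eL)
    _ = ∑ i, ∫ y, ⟪gaussWeight y • V y, fderiv ℝ (fderiv ℝ V) y (b i) (b i)⟫ :=
        integral_finsetSum _ fun i _ => I2 i
    _ = -∑ i, ((∫ y, ‖fderiv ℝ V y (b i)‖ ^ 2 * gaussWeight y) +
          (-(1 / 2 : ℝ)) * ∫ y, ⟪y, b i⟫ * ⟪V y, fderiv ℝ V y (b i)⟫ * gaussWeight y) := by
        rw [← Finset.sum_neg_distrib]
        refine Finset.sum_congr rfl fun i _ => ?_
        rw [hibp i]
        congr 1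
        simp_rw [eR i]
        rw [integral_add (J1 i) ((J2 i).const_mul _), integral_const_mul]
    _ = -(∫ y, frobeniusNormSq (fderiv ℝ V y) * gaussWeight y) +
          (1 / 2 : ℝ) * ∫ y, ⟪V y, fderiv ℝ V y y⟫ * gaussWeight y := by
        rw [Finset.sum_add_distrib, ← Finset.mul_sum, ← integral_finsetSum _ fun i _ => J1 i,
          ← integral_finsetSum _ fun i _ => J2 i]
        simp_rw [eY, ← Finset.sum_mul]
        simp only [frobeniusNormSq, hb_def]
        ring

end Summit.NavierStokesRegularity.NavierStokesRegularity.Theorems.HeadFluxChannelS2c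

/-! ## Registered sub-goal (the `ℝ³` form of the viscous identity) -/

namespace Summit.NavierStokesRegularity.NavierStokesRegularity.Theorems

open MeasureTheory
open scoped RealInnerProductSpace Laplacian

/-- **Registered sub-goal `gaussianEnergyIBP_laplacian`** of STUB S2c (the viscous term of the
Gaussian energy identity on `ℝ³`, rate class): for `V ∈ C²(ℝ³; ℝ³)` with `|V| ≤ A`, `|DV| ≤ B`,
`|D²V| ≤ B`, `∫ ⟨V, ΔV⟩ g = −∫ |DV|²_F g + ½ ∫ ⟨V, DV y⟩ g`
(`HeadFluxChannelS2c.integral_inner_laplacian_mul_gaussWeight'`). [folklore] -/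
theorem gaussianEnergyIBP_laplacian :
    ∀ (A B : ℝ) (V : EuclideanSpace ℝ (Fin 3) → EuclideanSpace ℝ (Fin 3)), ContDiff ℝ 2 V →
      (∀ y : EuclideanSpace ℝ (Fin 3), ‖V y‖ ≤ A) →
      (∀ y : EuclideanSpace ℝ (Fin 3), ‖fderiv ℝ V y‖ ≤ B) →
      (∀ y : EuclideanSpace ℝ (Fin 3), ‖iteratedFDeriv ℝ 2 V y‖ ≤ B) →
      (∫ y : EuclideanSpace ℝ (Fin 3), inner ℝ (V y) (Laplacian.laplacian V y) *
          Literature.Analysis.FluidPDE.PineauVicol2026.gaussWeight y) =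
        -(∫ y : EuclideanSpace ℝ (Fin 3), Literature.Analysis.FluidPDE.frobeniusNormSq (fderiv ℝ V y) *
            Literature.Analysis.FluidPDE.PineauVicol2026.gaussWeight y) +
          (1 / 2 : ℝ) * (∫ y : EuclideanSpace ℝ (Fin 3), inner ℝ (V y) (fderiv ℝ V y y) *
            Literature.Analysis.FluidPDE.PineauVicol2026.gaussWeight y) :=
  fun _ _ _ hV hA h1 h2 => HeadFluxChannelS2c.integral_inner_laplacian_mul_gaussWeight' hV hA h1 h2

end Summit.NavierStokesRegularity.NavierStokesRegularity.Theorems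

end
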